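import Literature.MathematicalPhysics.QuantumLattice.LatticeVectorHoppingInteraction
import HarnessLib

/-!
# One-band Hubbard families over hopping PAIRS: the `t–t'–t''–t‴` model of the square lattice, joint
# concavity / box floors / kinematic Lipschitz in all hopping amplitudes, and the `t‴` truncation residual
# `|e_ρ(t,t',t'',t‴,U) − e_ρ(t,t',t'',U)| ≤ (32/π²)|t‴|`

Topic `Literature/MathematicalPhysics/QuantumLattice` (family `hubbard`; §1–§2 general dimension `d`, §3 `ℤ²`).
Sequel of `LatticeVectorHoppingInteraction` (the hopping interaction `Φ_v` along one lattice vector, its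
pullback and the kinematic pair rows `|K_v + K_w| ≤ 16/π²`) and of `TIGroundEnergyDensityCouplingFamilies`
(the multi-parameter calculus of `linearFamily Ψ₀ Ψ θ` over any state class). Written for stage S2
(CERTIFIER-FAMILIES, «families of models») and the S1↔S2 seam of the Hubbard material-oracle programme: the
router's one-band boxes carry, besides `t, t', t''`, the knight-move amplitude `t‴` of the Wannier fit
(La₂CuO₄: `t‴/t = 0.055`), so far booked only as a heuristic inflation (INFL-TRUNC); here the four-hopping
model is a typed `FermionInteraction 2` and the truncation is a kernel inequality.

* §1 **hopping pair directions** `hoppingPairInteraction d v w := Φ_v^{1} + Φ_w^{1}` — the unit in which a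
  point-group-symmetric one-band Hamiltonian moves its couplings (on `ℤ²` every `D₄`-orbit of bond classes
  splits into `ℤ`-independent pairs); `e_{Φ_{v,w}}(ω) = K_v(ω) + K_w(ω)`; the norm row `|·| ≤ 4` (every
  state) and the kinematic row `|·| ≤ 16/π²` (every translation-invariant state, `latticePairMap v w`
  injective).
* §2 **`hubbardHoppingFamily τ₁ τ₂ U θ = Φ^{0,U} + Σ_a θ_a Φ_{τ₁ a, τ₂ a}`** (a `linearFamily`): even,
  Hermitian; by instantiation of the coupling-family calculus — JOINT CONCAVITY of the fixed-filling and of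
  the unconstrained translation-invariant ground-state energy densities in `θ`, BOX ⇒ WORD from the `2^|ι|`
  vertices, NORM LIPSCHITZ `Σ_a 4|Δθ_a|` (every class, every `d`), and **KINEMATIC LIPSCHITZ
  `(16/π²) Σ_a |Δθ_a|`** over every class of translation-invariant states, for the unconstrained density,
  and at every fixed filling (`abs_tiGroundEnergyDensityAt_hubbardHoppingFamily_sub_le_kinematic`).
* §3 (`ℤ²`) the five standard pairs `cuprateHopPair₁/₂ = (e₁|e₂), (e₁+e₂|e₁−e₂), (2e₁|2e₂), ((2,1)|(1,2)),
  ((2,−1)|(1,−2))` (all injective, all inside `[-2,2]²`), the **`t–t'–t''–t‴` interaction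
  `hubbardTT'T''T'''FermionInteraction t t' t'' t‴ U`** (the family at `θ = (t,t',t'',t‴,t‴)`), the
  DICTIONARY `hubbardHoppingFamily … U (t,t',t'',0,0) = hubbardTT'T''FermionInteraction t t' t'' U` (term by
  term; hence `…T''' t t' t'' 0 U = hubbardTT'T''FermionInteraction t t' t'' U`), and the consequences:
  `|e_ρ(t,t',t'',t‴,U) − e_ρ(t,t',s'',s‴,U)| ≤ (16/π²)(|t''−s''| + 2|t‴−s‴|)` at every filling (and for the
  unconstrained density), the **`t‴` TRUNCATION RESIDUAL `(32/π²)|t‴| < 3.243|t‴|`**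
  (`abs_tiGroundEnergyDensityAt_tppp_sub_tpp_le_kinematic`, unconstrained twin), the **OBJECT-M WORD**
  `|e_ρ(t,t',t'',t‴,U) − energyDensityTT' t t' U ρ| ≤ (16/π²)(|t''| + 2|t‴|)` (`U ≥ 0`, `0 < ρ < 2`) with
  its window form `tiGroundEnergyDensityAt_tpp_tppp_mem_Icc_of_window` (the shape
  `Downfold.holdsOn_inflate_of_lipschitz` consumes), and joint concavity in `(t,t',t'',t‴)`.
  Numbers (kinematic, certified `K` rows at an anchor shrink them): La₂CuO₄ object M, `t''/t ≤ 0.14`,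
  `t‴/t = 0.055` ⇒ `|Δe| ≤ 1.6212·(0.14 + 0.11) t = 0.41 t`.

* §4 (appended) the four-hopping mean energy TERM BY TERM, `e_{Φ(t,t',t'',t‴,U)}(ω) = e_{Φ(t,t',U)}(ω) +
  t''K₃(ω) + t‴K_kn(ω)` (`InfVolFermionState.knightEnergy = Σ_4 K_knight`, `|K_kn| ≤ 32/π²` for translation-invariant
  states), the TRIAL-STATE CAP PLANE over `(t'', t‴)` through any anchor state of the filling class
  (`tiGroundEnergyDensityAt_tppp_le_trial`), its certified sign-split form from an anchor cap `u` and windows on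
  `K₃(ω₀)`, `K_kn(ω₀)` (`…_le_cap_add_max`), and the kinematic form `u + (16/π²)(|t''| + 2|t‴|)` (`…_le_cap_add_kinematic`).

Everything is PROVED; definitions with bodies (`hoppingPairInteraction`, `hubbardHoppingFamily`,
`cuprateHopPair₁/₂`, `hubbardTT'T''T'''FermionInteraction`, `InfVolFermionState.knightEnergy`), no named fact, no number of record, no `sorry`.
HONEST SCOPE: energy words only; kinematic (one-body, filling-blind) constants; the single-direction sharp
constant `4/π` is not claimed; nothing bears on order / pairing words, and nothing here certifies a number
about a material.

## Mathlib / tree search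

REUSED: `vectorHoppingFermionInteraction` with `_isEven/_isHermitian/_smul_apply`, `abs_meanEnergy_vectorHopping_le`,
`latticePairMap`, `pairMap_injective_of_det_ne_zero`, `IsTranslationInvariant.abs_meanEnergy_vectorHopping_add_le`,
`knightVec(_mem_thicken_two)`, the dictionary lemmas `hubbardFermionInteraction_apply_eq_onSite_add_sum_vectorHopping`,
`diagHoppingFermionInteraction_apply_eq_sum_vectorHopping`, `axialRange2HoppingFermionInteraction_apply_eq_sum_vectorHopping`
(`LatticeVectorHoppingInteraction`); `linearFamily`, `isEven/isHermitian_linearFamily`, `concaveOn_tiGroundEnergyDensity(At)_linearFamily`,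
`le_tiGroundEnergyDensityAt_linearFamily_of_mem_Icc`, `abs_infMeanEnergyOn_linearFamily_sub_le`, `infMeanEnergyOn_empty`,
`tiGroundEnergyDensity(At)_eq_infMeanEnergyOn` (`TIGroundEnergyDensityCouplingFamilies`); `FermionInteraction.isEven_of_add`,
`isHermitian_of_add`, `meanEnergyObs_of_add`, `hubbardTTPrimeFermionInteraction_apply`, `diagVec_mem_thicken_one`
(`HubbardNNNHoppingInteraction`); `hubbardTT'T''FermionInteraction_apply` (`HubbardTTPrimeTPPInteraction`);
`tiGroundEnergyDensityAt_hubbardTT'T''_zero` (`HubbardTTPrimeTPPFillingTransport`); `axial2Vec_mem_thicken_two`,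
`unitVec_mem_thicken_one`, `thicken_mono`, `vacuumState_isTranslationInvariant`, `ConcaveOn.comp_linearMap`.
`lean search 'hoppingPair|hubbardHoppingFamily|knight' --decl`: nothing before this file and its prequel.

## References

* E. Pavarini, I. Dasgupta, T. Saha-Dasgupta, O. Jepsen, O. K. Andersen, PRL 87 (2001) 047003, eq. (1)
  (the one-band cuprate dispersion). [cite: PavariniEtAl2001, eq. (1)]
* R. B. Israel, *Convexity in the Theory of Lattice Gases* (1979), Thm. I.3.4 (concavity and Lipschitz
  continuity of ground-state / free energies in the interaction). [cite: Israel1979, Thm. I.3.4]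
* R. T. Rockafellar, *Convex Analysis* (1970), Thm. 32.2 (a concave function on a polytope attains its
  minimum at a vertex). [cite: Rockafellar1970, Thm 32.2]
* E. H. Lieb, M. Loss, Duke Math. J. 71 (1993) 337, §8 Thm. 8.2 (bathtub; `16/π²`). [cite: LiebLoss1993, §8, Theorem 8.2]
* H. Araki, H. Moriya, Rev. Math. Phys. 15 (2003) 93, §4.1, §5.1. [cite: ArakiMoriya2003, §4.1]
-/

noncomputable section

namespace Literature.MathematicalPhysics.QuantumLattice

open Matrix Finset HubbardWave0 Literature.Probability.LatticeModels ThermodynamicLimit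
open scoped ComplexOrder BigOperators

/-! ### §1. Hopping PAIR directions `Φ_{v,w} = Φ_v^{1} + Φ_w^{1}` and their class constants -/

section Pair

variable {d : ℕ}

/-- **The hopping pair direction** `Φ_{v,w} := Φ_v^{1} + Φ_w^{1}` (unit amplitude on the two bond classes
`±v`, `±w`): the unit in which a point-group-symmetric one-band Hamiltonian moves its couplings (on `ℤ²`
every `D₄`-orbit of bond classes splits into `ℤ`-independent pairs: `{e₁, e₂}`, `{e₁+e₂, e₁−e₂}`,
`{2e₁, 2e₂}`, the two knight pairs, …), and the unit for which a class-wide kinematic row is available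
(`LatticeVectorHoppingInteraction`: `|K_v + K_w| ≤ 16/π²`). [cite: PavariniEtAl2001, eq. (1)] -/
def hoppingPairInteraction (d : ℕ) (v w : Site d) : FermionInteraction d where
  Φ X := (vectorHoppingFermionInteraction d v 1).Φ X + (vectorHoppingFermionInteraction d w 1).Φ X

/-- The terms of the pair direction (definitional). [cite: PavariniEtAl2001, eq. (1)] -/
theorem hoppingPairInteraction_apply (v w : Site d) (X : Finset (Site d)) :
    (hoppingPairInteraction d v w).Φ X =
      (vectorHoppingFermionInteraction d v 1).Φ X + (vectorHoppingFermionInteraction d w 1).Φ X := rfl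

/-- The pair direction is even. [cite: ArakiMoriya2003, §1 assumption (II)] -/
theorem hoppingPairInteraction_isEven (v w : Site d) : (hoppingPairInteraction d v w).IsEven :=
  FermionInteraction.isEven_of_add (hoppingPairInteraction_apply v w) (vectorHoppingFermionInteraction_isEven v 1)
    (vectorHoppingFermionInteraction_isEven w 1)

/-- The pair direction is Hermitian. [cite: ArakiMoriya2003, §1 assumption (II)] -/
theorem hoppingPairInteraction_isHermitian (v w : Site d) : (hoppingPairInteraction d v w).IsHermitian :=
  FermionInteraction.isHermitian_of_add (hoppingPairInteraction_apply v w)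
    (vectorHoppingFermionInteraction_isHermitian v 1) (vectorHoppingFermionInteraction_isHermitian w 1)

/-- **`e_{Φ_{v,w}}(ω) = K_v(ω) + K_w(ω)`** for every state and range parameter. [cite: BratteliKishimotoRobinson1978, §3] -/
theorem InfVolFermionState.meanEnergy_hoppingPair (ω : InfVolFermionState d) (v w : Site d) (R : ℝ) :
    ω.meanEnergy (hoppingPairInteraction d v w) R =
      ω.meanEnergy (vectorHoppingFermionInteraction d v 1) R + ω.meanEnergy (vectorHoppingFermionInteraction d w 1) R := by
  simp only [InfVolFermionState.meanEnergy]
  rw [FermionInteraction.meanEnergyObs_of_add (hoppingPairInteraction_apply v w), map_add, Complex.add_re]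

/-- **Norm row of a pair direction**: `|e_{Φ_{v,w}}(ω)| ≤ 4` for EVERY state (`v, w ≠ 0` inside the range
box). [cite: BratteliRobinsonI1987, Prop. 2.3.11] -/
theorem InfVolFermionState.abs_meanEnergy_hoppingPair_le_four (ω : InfVolFermionState d) {v w : Site d}
    (hv : v ≠ 0) (hw : w ≠ 0) {R : ℝ} (hvR : v ∈ thicken ({0} : Finset (Site d)) R)
    (hwR : w ∈ thicken ({0} : Finset (Site d)) R) : |ω.meanEnergy (hoppingPairInteraction d v w) R| ≤ 4 := by
  rw [ω.meanEnergy_hoppingPair]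
  have h1 := abs_meanEnergy_vectorHopping_le hv 1 ω hvR
  have h2 := abs_meanEnergy_vectorHopping_le hw 1 ω hwR
  rw [abs_one, mul_one] at h1 h2
  calc _ ≤ |ω.meanEnergy (vectorHoppingFermionInteraction d v 1) R| +
        |ω.meanEnergy (vectorHoppingFermionInteraction d w 1) R| := abs_add_le _ _
    _ ≤ 2 + 2 := add_le_add h1 h2
    _ = 4 := by norm_num

/-- **Kinematic row of a pair direction**: `|e_{Φ_{v,w}}(ω)| ≤ 16/π²` for every translation-invariant
state, whenever `v, w` span a rank-2 sublattice (`latticePairMap v w` injective).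
[cite: LiebLoss1993, §8, Theorem 8.2] -/
theorem InfVolFermionState.IsTranslationInvariant.abs_meanEnergy_hoppingPair_le {ω : InfVolFermionState d}
    (hω : ω.IsTranslationInvariant) {v w : Site d} (hf : Function.Injective (latticePairMap v w)) {R : ℝ}
    (hvR : v ∈ thicken ({0} : Finset (Site d)) R) (hwR : w ∈ thicken ({0} : Finset (Site d)) R) :
    |ω.meanEnergy (hoppingPairInteraction d v w) R| ≤ 16 / Real.pi ^ 2 := by
  rw [ω.meanEnergy_hoppingPair]
  exact hω.abs_meanEnergy_vectorHopping_add_le hf hvR hwR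

end Pair

/-! ### §2. The one-band Hubbard family over hopping pairs -/

section Family

variable {d : ℕ} {ι : Type*} [Fintype ι]

/-- **The one-band Hubbard family over hopping pairs**: on-site repulsion `U` plus, for every coupling
index `a`, the amplitude `θ_a` on the pair of bond classes `(τ₁ a, τ₂ a)`:
`Ψ(θ) = Φ^{0,U} + Σ_a θ_a Φ_{τ₁ a, τ₂ a}` — a `FermionInteraction.linearFamily`, so the whole multi-parameter
calculus of `TIGroundEnergyDensityCouplingFamilies` (joint concavity, box-vertex floors, tangent planes,
Lipschitz, minimiser transport, energy-window words) applies to it by instantiation. On `ℤ²` with the standard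
pairs (§3) and `θ = (t, t', t'')` this IS the tree's `t–t'–t''` interaction; with two more knight pairs at a
common amplitude it is the `t–t'–t''–t‴` model of the downfolded cuprate bands. [cite: PavariniEtAl2001, eq. (1)] -/
def hubbardHoppingFamily (τ₁ τ₂ : ι → Site d) (U : ℝ) (θ : ι → ℝ) : FermionInteraction d :=
  FermionInteraction.linearFamily (hubbardFermionInteraction d 0 U) (fun a => hoppingPairInteraction d (τ₁ a) (τ₂ a)) θ

variable (τ₁ τ₂ : ι → Site d) (U : ℝ)

/-- The family is even. [cite: ArakiMoriya2003, §1 assumption (II)] -/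
theorem hubbardHoppingFamily_isEven (θ : ι → ℝ) : (hubbardHoppingFamily τ₁ τ₂ U θ).IsEven :=
  FermionInteraction.isEven_linearFamily (hubbardFermionInteraction_isEven 0 U)
    (fun a => hoppingPairInteraction_isEven (τ₁ a) (τ₂ a)) θ

/-- The family is Hermitian. [cite: ArakiMoriya2003, §1 assumption (II)] -/
theorem hubbardHoppingFamily_isHermitian (θ : ι → ℝ) : (hubbardHoppingFamily τ₁ τ₂ U θ).IsHermitian :=
  FermionInteraction.isHermitian_linearFamily (hubbardFermionInteraction_isHermitian 0 U)
    (fun a => hoppingPairInteraction_isHermitian (τ₁ a) (τ₂ a)) θ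

/-- **JOINT CONCAVITY of the fixed-filling ground-state energy density in all hopping amplitudes.**
[cite: Israel1979, Thm. I.3.4] -/
theorem concaveOn_tiGroundEnergyDensityAt_hubbardHoppingFamily (R ρ : ℝ) :
    ConcaveOn ℝ Set.univ fun θ : ι → ℝ => (hubbardHoppingFamily τ₁ τ₂ U θ).tiGroundEnergyDensityAt R ρ :=
  FermionInteraction.concaveOn_tiGroundEnergyDensityAt_linearFamily _ _ R ρ

/-- **JOINT CONCAVITY of the unconstrained translation-invariant ground-state energy density** (the object
of grand-canonical programs once a `−μn` term sits in the base). [cite: Israel1979, Thm. I.3.4] -/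
theorem concaveOn_tiGroundEnergyDensity_hubbardHoppingFamily (R : ℝ) :
    ConcaveOn ℝ Set.univ fun θ : ι → ℝ => (hubbardHoppingFamily τ₁ τ₂ U θ).tiGroundEnergyDensity R :=
  FermionInteraction.concaveOn_tiGroundEnergyDensity_linearFamily _ _ R

/-- **BOX ⇒ WORD over a hopping box**: a floor certified at the `2^|ι|` vertices of `[lo, hi]` holds at every
hopping vector of the box (fixed filling, fixed `U`). [cite: Rockafellar1970, Thm 32.2] -/
theorem le_tiGroundEnergyDensityAt_hubbardHoppingFamily_of_mem_Icc [DecidableEq ι] (R ρ : ℝ) (lo hi : ι → ℝ)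
    {m : ℝ} (hm : ∀ v ∈ Fintype.piFinset (fun a => ({lo a, hi a} : Finset ℝ)),
      m ≤ (hubbardHoppingFamily τ₁ τ₂ U v).tiGroundEnergyDensityAt R ρ)
    {θ : ι → ℝ} (hθ : θ ∈ Set.Icc lo hi) : m ≤ (hubbardHoppingFamily τ₁ τ₂ U θ).tiGroundEnergyDensityAt R ρ :=
  FermionInteraction.le_tiGroundEnergyDensityAt_linearFamily_of_mem_Icc _ _ R ρ lo hi hm hθ

/-- **NORM LIPSCHITZ (every class, every dimension)**: each hopping pair whose two vectors are nonzero and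
inside the range box moves ANY variational ground-state energy density by at most `4|Δθ_a|`.
[cite: Israel1979, Thm. I.3.4] -/
theorem abs_infMeanEnergyOn_hubbardHoppingFamily_sub_le_norm (S : Set (InfVolFermionState d)) {R : ℝ}
    (h₁ : ∀ a, τ₁ a ≠ 0) (h₂ : ∀ a, τ₂ a ≠ 0) (hR₁ : ∀ a, τ₁ a ∈ thicken ({0} : Finset (Site d)) R)
    (hR₂ : ∀ a, τ₂ a ∈ thicken ({0} : Finset (Site d)) R) (θ θ' : ι → ℝ) :
    |FermionInteraction.infMeanEnergyOn S (hubbardHoppingFamily τ₁ τ₂ U θ) R -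
        FermionInteraction.infMeanEnergyOn S (hubbardHoppingFamily τ₁ τ₂ U θ') R| ≤ ∑ a, 4 * |θ a - θ' a| := by
  rcases S.eq_empty_or_nonempty with rfl | hS
  · simp only [FermionInteraction.infMeanEnergyOn_empty, sub_self, abs_zero]
    exact Finset.sum_nonneg fun a _ => mul_nonneg (by norm_num) (abs_nonneg _)
  exact FermionInteraction.abs_infMeanEnergyOn_linearFamily_sub_le _ _ R hS
    (fun ω _ a => ω.abs_meanEnergy_hoppingPair_le_four (h₁ a) (h₂ a) (hR₁ a) (hR₂ a)) θ θ'

/-- **KINEMATIC LIPSCHITZ over any class of translation-invariant states** (non-empty `S`; every pair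
spanning a rank-2 sublattice): `|e_S(θ) − e_S(θ')| ≤ (16/π²) Σ_a |θ_a − θ'_a|`. [cite: Israel1979, Thm. I.3.4] -/
theorem abs_infMeanEnergyOn_hubbardHoppingFamily_sub_le_kinematic {S : Set (InfVolFermionState d)}
    (hS : S.Nonempty) (hTI : ∀ ω ∈ S, ω.IsTranslationInvariant) {R : ℝ}
    (hinj : ∀ a, Function.Injective (latticePairMap (τ₁ a) (τ₂ a)))
    (hR₁ : ∀ a, τ₁ a ∈ thicken ({0} : Finset (Site d)) R) (hR₂ : ∀ a, τ₂ a ∈ thicken ({0} : Finset (Site d)) R)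
    (θ θ' : ι → ℝ) :
    |FermionInteraction.infMeanEnergyOn S (hubbardHoppingFamily τ₁ τ₂ U θ) R -
        FermionInteraction.infMeanEnergyOn S (hubbardHoppingFamily τ₁ τ₂ U θ') R| ≤
      16 / Real.pi ^ 2 * ∑ a, |θ a - θ' a| := by
  rw [Finset.mul_sum]
  exact FermionInteraction.abs_infMeanEnergyOn_linearFamily_sub_le _ _ R hS
    (fun ω hω a => (hTI ω hω).abs_meanEnergy_hoppingPair_le (hinj a) (hR₁ a) (hR₂ a)) θ θ'

/-- **KINEMATIC LIPSCHITZ of the unconstrained translation-invariant ground-state energy density** (every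
`d`; the class is non-empty by the vacuum). [cite: Israel1979, Thm. I.3.4] -/
theorem abs_tiGroundEnergyDensity_hubbardHoppingFamily_sub_le_kinematic {R : ℝ}
    (hinj : ∀ a, Function.Injective (latticePairMap (τ₁ a) (τ₂ a)))
    (hR₁ : ∀ a, τ₁ a ∈ thicken ({0} : Finset (Site d)) R) (hR₂ : ∀ a, τ₂ a ∈ thicken ({0} : Finset (Site d)) R)
    (θ θ' : ι → ℝ) :
    |(hubbardHoppingFamily τ₁ τ₂ U θ).tiGroundEnergyDensity R - (hubbardHoppingFamily τ₁ τ₂ U θ').tiGroundEnergyDensity R| ≤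
      16 / Real.pi ^ 2 * ∑ a, |θ a - θ' a| := by
  rw [FermionInteraction.tiGroundEnergyDensity_eq_infMeanEnergyOn, FermionInteraction.tiGroundEnergyDensity_eq_infMeanEnergyOn]
  exact abs_infMeanEnergyOn_hubbardHoppingFamily_sub_le_kinematic τ₁ τ₂ U
    (S := {ω : InfVolFermionState d | ω.IsTranslationInvariant})
    ⟨_, InfVolFermionState.vacuumState_isTranslationInvariant (d := d)⟩ (fun ω hω => hω) hinj hR₁ hR₂ θ θ'

/-- **KINEMATIC LIPSCHITZ at fixed filling** (every filling `ρ`; an empty filling class has both sides `0`):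
`|e_ρ(θ) − e_ρ(θ')| ≤ (16/π²) Σ_a |θ_a − θ'_a|`. [cite: Israel1979, Thm. I.3.4] -/
theorem abs_tiGroundEnergyDensityAt_hubbardHoppingFamily_sub_le_kinematic {R : ℝ} (ρ : ℝ)
    (hinj : ∀ a, Function.Injective (latticePairMap (τ₁ a) (τ₂ a)))
    (hR₁ : ∀ a, τ₁ a ∈ thicken ({0} : Finset (Site d)) R) (hR₂ : ∀ a, τ₂ a ∈ thicken ({0} : Finset (Site d)) R)
    (θ θ' : ι → ℝ) :
    |(hubbardHoppingFamily τ₁ τ₂ U θ).tiGroundEnergyDensityAt R ρ -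
        (hubbardHoppingFamily τ₁ τ₂ U θ').tiGroundEnergyDensityAt R ρ| ≤ 16 / Real.pi ^ 2 * ∑ a, |θ a - θ' a| := by
  rw [FermionInteraction.tiGroundEnergyDensityAt_eq_infMeanEnergyOn, FermionInteraction.tiGroundEnergyDensityAt_eq_infMeanEnergyOn]
  rcases ({ω : InfVolFermionState d | ω.IsTranslationInvariant ∧ ω.density = ρ}).eq_empty_or_nonempty with h | hS
  · rw [h, FermionInteraction.infMeanEnergyOn_empty, FermionInteraction.infMeanEnergyOn_empty, sub_self, abs_zero]
    exact mul_nonneg (by positivity) (Finset.sum_nonneg fun a _ => abs_nonneg _)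
  exact abs_infMeanEnergyOn_hubbardHoppingFamily_sub_le_kinematic τ₁ τ₂ U hS (fun ω hω => hω.1) hinj hR₁ hR₂ θ θ'

/-- **LIPSCHITZ WITH CERTIFIED PAIR ROWS** (any class `S`, e.g. translation-invariant states of filling
`ρ`): class-wide brackets `|e_{Φ_{τ₁a,τ₂a}}(σ)| ≤ C_a` on the pair energies — kinematic (`16/π²`) or
CERTIFIED (`±(K_v + K_w)` objectives of an anchor relaxation) — give `|e_S(θ) − e_S(θ')| ≤ Σ_a C_a|θ_a − θ'_a|`.
[cite: Israel1979, Thm. I.3.4] -/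
theorem abs_infMeanEnergyOn_hubbardHoppingFamily_sub_le_of_rows {S : Set (InfVolFermionState d)}
    (hS : S.Nonempty) {R : ℝ} {C : ι → ℝ}
    (hC : ∀ ω ∈ S, ∀ a, |ω.meanEnergy (hoppingPairInteraction d (τ₁ a) (τ₂ a)) R| ≤ C a) (θ θ' : ι → ℝ) :
    |FermionInteraction.infMeanEnergyOn S (hubbardHoppingFamily τ₁ τ₂ U θ) R -
        FermionInteraction.infMeanEnergyOn S (hubbardHoppingFamily τ₁ τ₂ U θ') R| ≤ ∑ a, C a * |θ a - θ' a| :=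
  FermionInteraction.abs_infMeanEnergyOn_linearFamily_sub_le _ _ R hS hC θ θ'

/-- **AN ENERGY-WINDOW WORD AT ONE HOPPING VECTOR COVERS THE HOPPING BOX** (any class `S`, brackets
`[lo_a, hi_a]` on the pair energies class-wide): a word `P` certified at the anchor `θ₀` for every state of
`S` inside the energy window of slack `ε` holds for every `S`-minimiser of `Ψ(θ)` whenever
`Σ_a |θ_a − θ₀_a|(hi_a − lo_a) ≤ ε` (instance of `of_energyWindow_word_of_isMinOn`). [cite: WangEtAl2024, §III] -/
theorem hubbardHoppingFamily_energyWindow_word_of_isMinOn {S : Set (InfVolFermionState d)} {R : ℝ}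
    {P : InfVolFermionState d → Prop} {θ₀ : ι → ℝ} {ε : ℝ}
    (hword : ∀ σ ∈ S, σ.meanEnergy (hubbardHoppingFamily τ₁ τ₂ U θ₀) R ≤
      FermionInteraction.infMeanEnergyOn S (hubbardHoppingFamily τ₁ τ₂ U θ₀) R + ε → P σ)
    {lo hi : ι → ℝ} (hB : ∀ σ ∈ S, ∀ a, σ.meanEnergy (hoppingPairInteraction d (τ₁ a) (τ₂ a)) R ∈ Set.Icc (lo a) (hi a))
    {θ : ι → ℝ} (hθ : ∑ a, |θ a - θ₀ a| * (hi a - lo a) ≤ ε) {ω : InfVolFermionState d} (hω : ω ∈ S)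
    (hmin : IsMinOn (fun σ : InfVolFermionState d => σ.meanEnergy (hubbardHoppingFamily τ₁ τ₂ U θ) R) S ω) :
    P ω :=
  InfVolFermionState.of_energyWindow_word_of_isMinOn _ _ R hword hB hθ hω hmin

/-- **Kinematic form over translation-invariant classes**: with every pair spanning a rank-2 sublattice the
brackets are `[−16/π², 16/π²]`, so the budget is `(32/π²) Σ_a |θ_a − θ₀_a| ≤ ε`. [cite: WangEtAl2024, §III] -/
theorem hubbardHoppingFamily_energyWindow_word_of_isMinOn_kinematic {S : Set (InfVolFermionState d)}
    (hTI : ∀ ω ∈ S, ω.IsTranslationInvariant) {R : ℝ}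
    (hinj : ∀ a, Function.Injective (latticePairMap (τ₁ a) (τ₂ a)))
    (hR₁ : ∀ a, τ₁ a ∈ thicken ({0} : Finset (Site d)) R) (hR₂ : ∀ a, τ₂ a ∈ thicken ({0} : Finset (Site d)) R)
    {P : InfVolFermionState d → Prop} {θ₀ : ι → ℝ} {ε : ℝ}
    (hword : ∀ σ ∈ S, σ.meanEnergy (hubbardHoppingFamily τ₁ τ₂ U θ₀) R ≤
      FermionInteraction.infMeanEnergyOn S (hubbardHoppingFamily τ₁ τ₂ U θ₀) R + ε → P σ)
    {θ : ι → ℝ} (hθ : 32 / Real.pi ^ 2 * ∑ a, |θ a - θ₀ a| ≤ ε) {ω : InfVolFermionState d} (hω : ω ∈ S)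
    (hmin : IsMinOn (fun σ : InfVolFermionState d => σ.meanEnergy (hubbardHoppingFamily τ₁ τ₂ U θ) R) S ω) :
    P ω := by
  refine hubbardHoppingFamily_energyWindow_word_of_isMinOn τ₁ τ₂ U hword
    (lo := fun _ => -(16 / Real.pi ^ 2)) (hi := fun _ => 16 / Real.pi ^ 2)
    (fun σ hσ a => abs_le.1 ((hTI σ hσ).abs_meanEnergy_hoppingPair_le (hinj a) (hR₁ a) (hR₂ a))) ?_ hω hmin
  calc ∑ a, |θ a - θ₀ a| * (16 / Real.pi ^ 2 - -(16 / Real.pi ^ 2))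
      = 32 / Real.pi ^ 2 * ∑ a, |θ a - θ₀ a| := by rw [Finset.mul_sum]; exact Finset.sum_congr rfl fun a _ => by ring
    _ ≤ ε := hθ

end Family

/-! ### §3. The square lattice: the `t–t'–t''–t‴` one-band model and its truncation residuals -/

section Square

/-- First vectors of the five standard hopping pairs of `ℤ²`: `e₁`, `e₁+e₂`, `2e₁`, knight `(2,1)`,
knight `(2,−1)`. [cite: PavariniEtAl2001, eq. (1)] -/
def cuprateHopPair₁ : Fin 5 → Site 2 := ![unitVec 0, diagVec 0, axial2Vec 0, knightVec 0, knightVec 2]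

/-- Second vectors of the five standard hopping pairs of `ℤ²`: `e₂`, `e₁−e₂`, `2e₂`, knight `(1,2)`,
knight `(1,−2)`. [cite: PavariniEtAl2001, eq. (1)] -/
def cuprateHopPair₂ : Fin 5 → Site 2 := ![unitVec 1, diagVec 1, axial2Vec 1, knightVec 1, knightVec 3]

/-- Every standard pair spans a rank-2 sublattice (`det = 1, −2, 4, 3, −3`). [cite: ArakiMoriya2003, §4.1] -/
theorem cuprateHopPair_injective (a : Fin 5) :
    Function.Injective (latticePairMap (cuprateHopPair₁ a) (cuprateHopPair₂ a)) := by
  refine pairMap_injective_of_det_ne_zero ?_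
  fin_cases a <;>
    simp [cuprateHopPair₁, cuprateHopPair₂, unitVec, diagVec_apply_one, axial2Vec, knightVec]

/-- The first vectors lie in the range box `[-2,2]²`. [cite: FriedliVelenik2017, §3.2] -/
theorem cuprateHopPair₁_mem_thicken_two (a : Fin 5) : cuprateHopPair₁ a ∈ thicken ({0} : Finset (Site 2)) 2 := by
  fin_cases a
  · exact thicken_mono _ (by norm_num : (1 : ℝ) ≤ 2) (unitVec_mem_thicken_one 0)
  · exact thicken_mono _ (by norm_num : (1 : ℝ) ≤ 2) (diagVec_mem_thicken_one 0)
  · exact axial2Vec_mem_thicken_two 0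
  · exact knightVec_mem_thicken_two 0
  · exact knightVec_mem_thicken_two 2

/-- The second vectors lie in the range box `[-2,2]²`. [cite: FriedliVelenik2017, §3.2] -/
theorem cuprateHopPair₂_mem_thicken_two (a : Fin 5) : cuprateHopPair₂ a ∈ thicken ({0} : Finset (Site 2)) 2 := by
  fin_cases a
  · exact thicken_mono _ (by norm_num : (1 : ℝ) ≤ 2) (unitVec_mem_thicken_one 1)
  · exact thicken_mono _ (by norm_num : (1 : ℝ) ≤ 2) (diagVec_mem_thicken_one 1)
  · exact axial2Vec_mem_thicken_two 1
  · exact knightVec_mem_thicken_two 1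
  · exact knightVec_mem_thicken_two 3

/-- **The `t–t'–t''–t‴` one-band Hubbard interaction of the square lattice** (nearest, diagonal, axial
range-2 and knight-move hoppings, on-site `U`): the standard-pair family at `θ = (t, t', t'', t‴, t‴)`.
The one-electron part is the four-parameter dispersion of the downfolded cuprate conduction band
(Pavarini et al. 2001 eq. (1) extended by the knight term the Wannier fits print).
[cite: PavariniEtAl2001, eq. (1)] -/
def hubbardTT'T''T'''FermionInteraction (t t' t'' t''' U : ℝ) : FermionInteraction 2 :=
  hubbardHoppingFamily cuprateHopPair₁ cuprateHopPair₂ U ![t, t', t'', t''', t''']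

/-- `Φ_v^{t} X = t • Φ_v^{1} X`. [cite: PavariniEtAl2001, eq. (1)] -/
theorem vectorHoppingFermionInteraction_eq_smul_one {d : ℕ} (v : Site d) (t : ℝ) (X : Finset (Site d)) :
    (vectorHoppingFermionInteraction d v t).Φ X = (t : ℂ) • (vectorHoppingFermionInteraction d v 1).Φ X := by
  have h := vectorHoppingFermionInteraction_smul_apply v t 1 X
  rwa [mul_one] at h

/-- **DICTIONARY: the standard-pair family at `θ = (t, t', t'', 0, 0)` IS the tree's `t–t'–t''` interaction**
(term by term). [cite: PavariniEtAl2001, eq. (1)] -/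
theorem hubbardHoppingFamily_cuprate_eq_hubbardTT'T'' (t t' t'' U : ℝ) :
    hubbardHoppingFamily cuprateHopPair₁ cuprateHopPair₂ U ![t, t', t'', 0, 0] =
      hubbardTT'T''FermionInteraction t t' t'' U := by
  refine FermionInteraction.ext fun X => ?_
  rw [hubbardTT'T''FermionInteraction_apply, hubbardTTPrimeFermionInteraction_apply,
    hubbardFermionInteraction_apply_eq_onSite_add_sum_vectorHopping t U X,
    diagHoppingFermionInteraction_apply_eq_sum_vectorHopping, axialRange2HoppingFermionInteraction_apply_eq_sum_vectorHopping,
    Fin.sum_univ_two, Fin.sum_univ_two, Fin.sum_univ_two,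
    vectorHoppingFermionInteraction_eq_smul_one (unitVec 0) t, vectorHoppingFermionInteraction_eq_smul_one (unitVec 1) t,
    vectorHoppingFermionInteraction_eq_smul_one (diagVec 0) t', vectorHoppingFermionInteraction_eq_smul_one (diagVec 1) t',
    vectorHoppingFermionInteraction_eq_smul_one (axial2Vec 0) t'',
    vectorHoppingFermionInteraction_eq_smul_one (axial2Vec 1) t'']
  rw [hubbardHoppingFamily, FermionInteraction.linearFamily_apply, Fin.sum_univ_five]
  simp only [hoppingPairInteraction_apply, cuprateHopPair₁, cuprateHopPair₂, Matrix.cons_val_zero, Matrix.cons_val_one,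
    Matrix.cons_val_two, Matrix.cons_val_three, Matrix.cons_val_four, Matrix.head_cons, Matrix.tail_cons,
    Complex.ofReal_zero, zero_smul, add_zero, smul_add]
  abel

/-- **At `t‴ = 0` the four-parameter model is the `t–t'–t''` model.** [cite: PavariniEtAl2001, eq. (1)] -/
theorem hubbardTT'T''T'''FermionInteraction_zero (t t' t'' U : ℝ) :
    hubbardTT'T''T'''FermionInteraction t t' t'' 0 U = hubbardTT'T''FermionInteraction t t' t'' U :=
  hubbardHoppingFamily_cuprate_eq_hubbardTT'T'' t t' t'' U

/-- `Σ_a |θ_a − θ'_a|` for the two coupling vectors `(t,t',t'',t‴,t‴)` and `(t,t',s'',s‴,s‴)`: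
`|t'' − s''| + 2|t‴ − s‴|`. [cite: PavariniEtAl2001, eq. (1)] -/
theorem sum_abs_sub_cuprate (t t' t'' t''' s'' s''' : ℝ) :
    ∑ a : Fin 5, |(![t, t', t'', t''', t'''] : Fin 5 → ℝ) a - (![t, t', s'', s''', s'''] : Fin 5 → ℝ) a| =
      |t'' - s''| + 2 * |t''' - s'''| := by
  simp only [Fin.sum_univ_five, Matrix.cons_val_zero, Matrix.cons_val_one, Matrix.cons_val_two,
    Matrix.cons_val_three, Matrix.cons_val_four, Matrix.head_cons, Matrix.tail_cons, sub_self, abs_zero, zero_add]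
  ring

/-- **KINEMATIC `(t'', t‴)`-TRANSPORT AT FIXED FILLING** (every filling `ρ`, every `t, t', U`):
`|e_ρ(t,t',t'',t‴,U) − e_ρ(t,t',s'',s‴,U)| ≤ (16/π²)(|t'' − s''| + 2|t‴ − s‴|)` — the `t''` classes form one
standard pair, the `t‴` classes two. [cite: Israel1979, Thm. I.3.4] -/
theorem abs_tiGroundEnergyDensityAt_tpp_tppp_sub_le_kinematic (t t' U t'' t''' s'' s''' ρ : ℝ) :
    |(hubbardTT'T''T'''FermionInteraction t t' t'' t''' U).tiGroundEnergyDensityAt 2 ρ -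
        (hubbardTT'T''T'''FermionInteraction t t' s'' s''' U).tiGroundEnergyDensityAt 2 ρ| ≤
      16 / Real.pi ^ 2 * (|t'' - s''| + 2 * |t''' - s'''|) := by
  rw [← sum_abs_sub_cuprate t t' t'' t''' s'' s''']
  exact abs_tiGroundEnergyDensityAt_hubbardHoppingFamily_sub_le_kinematic _ _ U ρ cuprateHopPair_injective
    cuprateHopPair₁_mem_thicken_two cuprateHopPair₂_mem_thicken_two _ _

/-- **KINEMATIC `(t'', t‴)`-TRANSPORT, UNCONSTRAINED** translation-invariant ground-state energy density (the
object of `Downfold/TppSeam*`). [cite: Israel1979, Thm. I.3.4] -/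
theorem abs_tiGroundEnergyDensity_tpp_tppp_sub_le_kinematic (t t' U t'' t''' s'' s''' : ℝ) :
    |(hubbardTT'T''T'''FermionInteraction t t' t'' t''' U).tiGroundEnergyDensity 2 -
        (hubbardTT'T''T'''FermionInteraction t t' s'' s''' U).tiGroundEnergyDensity 2| ≤
      16 / Real.pi ^ 2 * (|t'' - s''| + 2 * |t''' - s'''|) := by
  rw [← sum_abs_sub_cuprate t t' t'' t''' s'' s''']
  exact abs_tiGroundEnergyDensity_hubbardHoppingFamily_sub_le_kinematic _ _ U cuprateHopPair_injective
    cuprateHopPair₁_mem_thicken_two cuprateHopPair₂_mem_thicken_two _ _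

/-- **THE `t‴` TRUNCATION RESIDUAL (INFL-TRUNC in kernel form)**: dropping the knight hopping moves the
fixed-filling ground-state energy density by at most `(32/π²)|t‴| < 3.243|t‴|`:
`|e_ρ(t,t',t'',t‴,U) − e_ρ(t,t',t'',U)| ≤ (32/π²)|t‴|`. [cite: Israel1979, Thm. I.3.4] -/
theorem abs_tiGroundEnergyDensityAt_tppp_sub_tpp_le_kinematic (t t' t'' t''' U ρ : ℝ) :
    |(hubbardTT'T''T'''FermionInteraction t t' t'' t''' U).tiGroundEnergyDensityAt 2 ρ -
        (hubbardTT'T''FermionInteraction t t' t'' U).tiGroundEnergyDensityAt 2 ρ| ≤ 32 / Real.pi ^ 2 * |t'''| := by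
  have h := abs_tiGroundEnergyDensityAt_tpp_tppp_sub_le_kinematic t t' U t'' t''' t'' 0 ρ
  rw [hubbardTT'T''T'''FermionInteraction_zero, sub_self, abs_zero, zero_add, sub_zero] at h
  calc _ ≤ 16 / Real.pi ^ 2 * (2 * |t'''|) := h
    _ = 32 / Real.pi ^ 2 * |t'''| := by ring

/-- The unconstrained twin: `|e₀(t,t',t'',t‴,U) − e₀(t,t',t'',U)| ≤ (32/π²)|t‴|`. [cite: Israel1979, Thm. I.3.4] -/
theorem abs_tiGroundEnergyDensity_tppp_sub_tpp_le_kinematic (t t' t'' t''' U : ℝ) :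
    |(hubbardTT'T''T'''FermionInteraction t t' t'' t''' U).tiGroundEnergyDensity 2 -
        (hubbardTT'T''FermionInteraction t t' t'' U).tiGroundEnergyDensity 2| ≤ 32 / Real.pi ^ 2 * |t'''| := by
  have h := abs_tiGroundEnergyDensity_tpp_tppp_sub_le_kinematic t t' U t'' t''' t'' 0
  rw [hubbardTT'T''T'''FermionInteraction_zero, sub_self, abs_zero, zero_add, sub_zero] at h
  calc _ ≤ 16 / Real.pi ^ 2 * (2 * |t'''|) := h
    _ = 32 / Real.pi ^ 2 * |t'''| := by ring

/-- **OBJECT-M WORD WITH `t''` AND `t‴` FROM A CERTIFIED `t–t'` WINDOW** (`U ≥ 0`, `0 < ρ < 2`):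
`|e_ρ(t,t',t'',t‴,U) − energyDensityTT' t t' U ρ| ≤ (16/π²)(|t''| + 2|t‴|)` — the fixed-filling
ground-state energy density of the four-hopping model is within the kinematic budget of Ruelle's
thermodynamic-limit `t–t'` energy density (the tree's bridge `tiGroundEnergyDensityAt_hubbardTT'T''_zero`).
[cite: Israel1979, Thm. I.3.4] -/
theorem abs_tiGroundEnergyDensityAt_tpp_tppp_sub_energyDensityTT'_le_kinematic (t t' : ℝ) {U : ℝ} (hU : 0 ≤ U)
    {ρ : ℝ} (hρ0 : 0 < ρ) (hρ2 : ρ < 2) (t'' t''' : ℝ) :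
    |(hubbardTT'T''T'''FermionInteraction t t' t'' t''' U).tiGroundEnergyDensityAt 2 ρ - energyDensityTT' t t' U ρ| ≤
      16 / Real.pi ^ 2 * (|t''| + 2 * |t'''|) := by
  have h := abs_tiGroundEnergyDensityAt_tpp_tppp_sub_le_kinematic t t' U t'' t''' 0 0 ρ
  rwa [hubbardTT'T''T'''FermionInteraction_zero, tiGroundEnergyDensityAt_hubbardTT'T''_zero t t' hU hρ0 hρ2, sub_zero,
    sub_zero] at h

/-- **Window form** (the shape `Downfold.holdsOn_inflate_of_lipschitz` consumes): a certified window
`lo ≤ energyDensityTT' t t' U ρ ≤ hi` gives, for every `t'', t‴`,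
`e_ρ(t,t',t'',t‴,U) ∈ [lo − (16/π²)(|t''| + 2|t‴|), hi + (16/π²)(|t''| + 2|t‴|)]`. [cite: Israel1979, Thm. I.3.4] -/
theorem tiGroundEnergyDensityAt_tpp_tppp_mem_Icc_of_window (t t' : ℝ) {U : ℝ} (hU : 0 ≤ U) {ρ : ℝ} (hρ0 : 0 < ρ)
    (hρ2 : ρ < 2) {lo hi : ℝ} (hlo : lo ≤ energyDensityTT' t t' U ρ) (hhi : energyDensityTT' t t' U ρ ≤ hi)
    (t'' t''' : ℝ) :
    (hubbardTT'T''T'''FermionInteraction t t' t'' t''' U).tiGroundEnergyDensityAt 2 ρ ∈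
      Set.Icc (lo - 16 / Real.pi ^ 2 * (|t''| + 2 * |t'''|)) (hi + 16 / Real.pi ^ 2 * (|t''| + 2 * |t'''|)) := by
  have h := abs_sub_le_iff.1 (abs_tiGroundEnergyDensityAt_tpp_tppp_sub_energyDensityTT'_le_kinematic t t' hU hρ0 hρ2 t'' t''')
  constructor <;> linarith [h.1, h.2]

/-- The four-hopping model's mean energy at the `t–t'` anchor `(t, t', 0, 0)` is the `t–t'` mean energy at
range `1` (range glue). [cite: BratteliKishimotoRobinson1978, §3] -/
theorem InfVolFermionState.meanEnergy_hubbardTT'T''T'''_zero_zero (ω : InfVolFermionState 2) (t t' U : ℝ) :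
    ω.meanEnergy (hubbardTT'T''T'''FermionInteraction t t' 0 0 U) 2 =
      ω.meanEnergy (hubbardTTPrimeFermionInteraction t t' U) 1 := by
  rw [hubbardTT'T''T'''FermionInteraction_zero, hubbardTT'T''FermionInteraction_zero,
    ω.meanEnergy_hubbardTTPrime_eq_one t t' U (by norm_num : (1 : ℝ) ≤ 2)]

/-- **A `t–t'` ANCHOR WORD COVERS THE `(t'', t‴)` BOX.** Let `P` be an energy-window word certified at the
`t–t'` anchor for the filling class: every translation-invariant `σ` of density `ρ` with
`e_{Φ(t,t',U)}(σ) ≤ energyDensityTT' t t' U ρ + ε` satisfies `P` (the shape of the tree's anchor SDP words,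
`HubbardTTPrimeAnchorWordBoxTransport`; `U ≥ 0`, `0 < ρ < 2`). Then `P` holds for every fixed-filling
ground state (class minimiser) of the `t–t'–t''–t‴` model whenever `(32/π²)(|t''| + 2|t‴|) ≤ ε`.
[cite: WangEtAl2024, §III] -/
theorem hubbardTT'T''T'''_energyWindow_word_of_isMinOn_kinematic (t t' : ℝ) {U : ℝ} (hU : 0 ≤ U) {ρ : ℝ}
    (hρ0 : 0 < ρ) (hρ2 : ρ < 2) {P : InfVolFermionState 2 → Prop} {ε : ℝ}
    (hword : ∀ σ : InfVolFermionState 2, σ.IsTranslationInvariant → σ.density = ρ →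
      σ.meanEnergy (hubbardTTPrimeFermionInteraction t t' U) 1 ≤ energyDensityTT' t t' U ρ + ε → P σ)
    {t'' t''' : ℝ} (hbudget : 32 / Real.pi ^ 2 * (|t''| + 2 * |t'''|) ≤ ε) {ω : InfVolFermionState 2}
    (hω : ω.IsTranslationInvariant) (hωρ : ω.density = ρ)
    (hmin : IsMinOn (fun σ : InfVolFermionState 2 => σ.meanEnergy (hubbardTT'T''T'''FermionInteraction t t' t'' t''' U) 2)
      {σ : InfVolFermionState 2 | σ.IsTranslationInvariant ∧ σ.density = ρ} ω) : P ω := by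
  have hanchor : FermionInteraction.infMeanEnergyOn {σ : InfVolFermionState 2 | σ.IsTranslationInvariant ∧ σ.density = ρ}
      (hubbardHoppingFamily cuprateHopPair₁ cuprateHopPair₂ U ![t, t', 0, 0, 0]) 2 = energyDensityTT' t t' U ρ := by
    rw [← FermionInteraction.tiGroundEnergyDensityAt_eq_infMeanEnergyOn,
      show hubbardHoppingFamily cuprateHopPair₁ cuprateHopPair₂ U ![t, t', 0, 0, 0] =
        hubbardTT'T''T'''FermionInteraction t t' 0 0 U from rfl,
      hubbardTT'T''T'''FermionInteraction_zero, tiGroundEnergyDensityAt_hubbardTT'T''_zero t t' hU hρ0 hρ2]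
  refine hubbardHoppingFamily_energyWindow_word_of_isMinOn_kinematic cuprateHopPair₁ cuprateHopPair₂ U
    (S := {σ : InfVolFermionState 2 | σ.IsTranslationInvariant ∧ σ.density = ρ}) (fun σ hσ => hσ.1)
    cuprateHopPair_injective cuprateHopPair₁_mem_thicken_two cuprateHopPair₂_mem_thicken_two
    (θ₀ := ![t, t', 0, 0, 0]) (ε := ε) (fun σ hσ hle => hword σ hσ.1 hσ.2 ?_) (θ := ![t, t', t'', t''', t'''])
    ?_ ⟨hω, hωρ⟩ hmin
  · rwa [hanchor, show hubbardHoppingFamily cuprateHopPair₁ cuprateHopPair₂ U ![t, t', 0, 0, 0] =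
        hubbardTT'T''T'''FermionInteraction t t' 0 0 U from rfl, σ.meanEnergy_hubbardTT'T''T'''_zero_zero] at hle
  · have hs : ∑ a : Fin 5, |(![t, t', t'', t''', t'''] : Fin 5 → ℝ) a - (![t, t', 0, 0, 0] : Fin 5 → ℝ) a| =
        |t''| + 2 * |t'''| := by
      have h := sum_abs_sub_cuprate t t' t'' t''' 0 0
      rwa [sub_zero, sub_zero] at h
    rwa [hs]

/-- **Joint concavity of the four-hopping fixed-filling energy density in `(t, t', t'', t‴)`** — chords
between certified anchors are floors, tangent planes at anchors are caps, exactly as for the `t–t'` objects.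
[cite: Israel1979, Thm. I.3.4] -/
theorem concaveOn_tiGroundEnergyDensityAt_tppp (U ρ : ℝ) :
    ConcaveOn ℝ Set.univ fun θ : Fin 4 → ℝ =>
      (hubbardTT'T''T'''FermionInteraction (θ 0) (θ 1) (θ 2) (θ 3) U).tiGroundEnergyDensityAt 2 ρ := by
  -- the four-parameter model is the family composed with the linear map `θ ↦ (θ₀, θ₁, θ₂, θ₃, θ₃)`
  let L : (Fin 4 → ℝ) →ₗ[ℝ] (Fin 5 → ℝ) :=
    { toFun := fun θ => ![θ 0, θ 1, θ 2, θ 3, θ 3]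
      map_add' := fun θ θ' => by
        ext a; fin_cases a <;> simp
      map_smul' := fun c θ => by
        ext a; fin_cases a <;> simp }
  have h := (concaveOn_tiGroundEnergyDensityAt_hubbardHoppingFamily cuprateHopPair₁ cuprateHopPair₂ U 2 ρ).comp_linearMap L
  refine ⟨convex_univ, fun θ _ θ' _ a b ha hb hab => ?_⟩
  have h' := h.2 (Set.mem_univ θ) (Set.mem_univ θ') ha hb hab
  simpa [L, hubbardTT'T''T'''FermionInteraction] using h'

end Square


/-! ### §4. The four-hopping mean energy term by term, and CAPS over the `(t'', t‴)` plane from ONE anchor state -/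

section AnchorCaps

/-- **The knight-move bond energy per site** of a state (unit amplitude on all four classes):
`K_kn(ω) := e_{Φ_{(2,1),(1,2)}}(ω) + e_{Φ_{(2,−1),(1,−2)}}(ω) = Σ_{k<4} K_{knight k}(ω)`. [cite: PavariniEtAl2001, eq. (1)] -/
def InfVolFermionState.knightEnergy (ω : InfVolFermionState 2) : ℝ :=
  ω.meanEnergy (hoppingPairInteraction 2 (knightVec 0) (knightVec 1)) 2 +
    ω.meanEnergy (hoppingPairInteraction 2 (knightVec 2) (knightVec 3)) 2

/-- `K_kn(ω) = Σ_{k<4} K_{knight k}(ω)`. [cite: PavariniEtAl2001, eq. (1)] -/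
theorem InfVolFermionState.knightEnergy_eq_sum (ω : InfVolFermionState 2) :
    ω.knightEnergy = ∑ k : Fin 4, ω.meanEnergy (vectorHoppingFermionInteraction 2 (knightVec k) 1) 2 := by
  rw [InfVolFermionState.knightEnergy, ω.meanEnergy_hoppingPair, ω.meanEnergy_hoppingPair, Fin.sum_univ_four]
  ring

/-- **`|K_kn(ω)| ≤ 32/π²` for every translation-invariant state.** [cite: LiebLoss1993, §8, Theorem 8.2] -/
theorem InfVolFermionState.IsTranslationInvariant.abs_knightEnergy_le {ω : InfVolFermionState 2}
    (hω : ω.IsTranslationInvariant) : |ω.knightEnergy| ≤ 32 / Real.pi ^ 2 := by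
  rw [ω.knightEnergy_eq_sum]
  exact hω.abs_sum_meanEnergy_knight_le

/-- **THE FOUR-HOPPING MEAN ENERGY, TERM BY TERM** (every state): `e_{Φ(t,t',t'',t‴,U)}(ω) =
e_{Φ(t,t',U)}(ω) + t''·K₃(ω) + t‴·K_kn(ω)` (`e_{Φ(t,t',U)}` at range `1`, `K₃` the unit axial range-2
energy at range `2`) — the affine formula behind witness planes and tangent caps for the four-hopping model.
[cite: BratteliKishimotoRobinson1978, §3 (mean energy functional)] -/
theorem InfVolFermionState.meanEnergy_hubbardTT'T''T''' (ω : InfVolFermionState 2) (t t' t'' t''' U : ℝ) :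
    ω.meanEnergy (hubbardTT'T''T'''FermionInteraction t t' t'' t''' U) 2 =
      ω.meanEnergy (hubbardTTPrimeFermionInteraction t t' U) 1 +
        t'' * ω.meanEnergy (axialRange2HoppingFermionInteraction 2 1) 2 + t''' * ω.knightEnergy := by
  have h := ω.meanEnergy_linearFamily_eq_add_sum_sub_mul (hubbardFermionInteraction 2 0 U)
    (fun a => hoppingPairInteraction 2 (cuprateHopPair₁ a) (cuprateHopPair₂ a)) ![t, t', t'', t''', t''']
    ![t, t', 0, 0, 0] 2
  rw [← hubbardHoppingFamily, ← hubbardHoppingFamily, ← hubbardTT'T''T'''FermionInteraction,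
    ← hubbardTT'T''T'''FermionInteraction, ω.meanEnergy_hubbardTT'T''T'''_zero_zero] at h
  rw [h, Fin.sum_univ_five, InfVolFermionState.knightEnergy, ω.meanEnergy_axialRange2Hopping_eq_sum_vectorHopping,
    Fin.sum_univ_two, ← ω.meanEnergy_hoppingPair]
  simp only [cuprateHopPair₁, cuprateHopPair₂, Matrix.cons_val_zero, Matrix.cons_val_one, Matrix.cons_val_two,
    Matrix.cons_val_three, Matrix.cons_val_four, Matrix.head_cons, Matrix.tail_cons, sub_self, zero_mul, sub_zero,
    zero_add]
  ring

/-- **TRIAL-STATE (WITNESS) CAP over the `(t'', t‴)` plane**: for every translation-invariant `ω₀` of density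
`ρ` (e.g. the torus limit of a certified upper-bound state, or a torus-limit ground state of the `t–t'`
anchor), `e_ρ(t,t',t'',t‴,U) ≤ e_{Φ(t,t',U)}(ω₀) + t''·K₃(ω₀) + t‴·K_kn(ω₀)` — a cap PLANE through the
anchor value with the anchor state's own third- and fourth-neighbour bond energies as slopes.
[cite: KomaTasaki1994, §1] -/
theorem tiGroundEnergyDensityAt_tppp_le_trial {ω₀ : InfVolFermionState 2} (hω₀ : ω₀.IsTranslationInvariant)
    {ρ : ℝ} (hρ : ω₀.density = ρ) (t t' t'' t''' U : ℝ) :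
    (hubbardTT'T''T'''FermionInteraction t t' t'' t''' U).tiGroundEnergyDensityAt 2 ρ ≤
      ω₀.meanEnergy (hubbardTTPrimeFermionInteraction t t' U) 1 +
        t'' * ω₀.meanEnergy (axialRange2HoppingFermionInteraction 2 1) 2 + t''' * ω₀.knightEnergy := by
  rw [← ω₀.meanEnergy_hubbardTT'T''T''']
  exact FermionInteraction.tiGroundEnergyDensityAt_le_meanEnergy _ _ hω₀ hρ

/-- **CERTIFIED CAP over the `(t'', t‴)` plane from three anchor numbers** (sign-split): a certified cap
`e_{Φ(t,t',U)}(ω₀) ≤ u` on an anchor state of density `ρ` (for a torus-limit ground state: a certified UPPER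
row on `energyDensityTT' t t' U ρ`) and certified windows `K₃(ω₀) ∈ [a₃, b₃]`, `K_kn(ω₀) ∈ [a₄, b₄]` (anchor
SDP objectives) give `e_ρ(t,t',t'',t‴,U) ≤ u + max(t''a₃, t''b₃) + max(t‴a₄, t‴b₄)` for EVERY `t'', t‴`.
[cite: KomaTasaki1994, §1] -/
theorem tiGroundEnergyDensityAt_tppp_le_cap_add_max {ω₀ : InfVolFermionState 2} (hω₀ : ω₀.IsTranslationInvariant)
    {ρ : ℝ} (hρ : ω₀.density = ρ) (t t' U : ℝ) {u a₃ b₃ a₄ b₄ : ℝ}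
    (hu : ω₀.meanEnergy (hubbardTTPrimeFermionInteraction t t' U) 1 ≤ u)
    (h₃ : ω₀.meanEnergy (axialRange2HoppingFermionInteraction 2 1) 2 ∈ Set.Icc a₃ b₃)
    (h₄ : ω₀.knightEnergy ∈ Set.Icc a₄ b₄) (t'' t''' : ℝ) :
    (hubbardTT'T''T'''FermionInteraction t t' t'' t''' U).tiGroundEnergyDensityAt 2 ρ ≤
      u + max (t'' * a₃) (t'' * b₃) + max (t''' * a₄) (t''' * b₄) := by
  refine (tiGroundEnergyDensityAt_tppp_le_trial hω₀ hρ t t' t'' t''' U).trans ?_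
  have hx : t'' * ω₀.meanEnergy (axialRange2HoppingFermionInteraction 2 1) 2 ≤ max (t'' * a₃) (t'' * b₃) := by
    rcases le_total 0 t'' with ht | ht
    · exact (mul_le_mul_of_nonneg_left h₃.2 ht).trans (le_max_right _ _)
    · exact (mul_le_mul_of_nonpos_left h₃.1 ht).trans (le_max_left _ _)
  have hy : t''' * ω₀.knightEnergy ≤ max (t''' * a₄) (t''' * b₄) := by
    rcases le_total 0 t''' with ht | ht
    · exact (mul_le_mul_of_nonneg_left h₄.2 ht).trans (le_max_right _ _)
    · exact (mul_le_mul_of_nonpos_left h₄.1 ht).trans (le_max_left _ _)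
  linarith

/-- **Kinematic cap from an anchor cap alone**: with only the class-wide rows `|K₃| ≤ 16/π²`, `|K_kn| ≤ 32/π²`
for the anchor state, `e_ρ(t,t',t'',t‴,U) ≤ u + (16/π²)(|t''| + 2|t‴|)`. [cite: LiebLoss1993, §8, Theorem 8.2] -/
theorem tiGroundEnergyDensityAt_tppp_le_cap_add_kinematic {ω₀ : InfVolFermionState 2} (hω₀ : ω₀.IsTranslationInvariant)
    {ρ : ℝ} (hρ : ω₀.density = ρ) (t t' U : ℝ) {u : ℝ}
    (hu : ω₀.meanEnergy (hubbardTTPrimeFermionInteraction t t' U) 1 ≤ u) (t'' t''' : ℝ) :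
    (hubbardTT'T''T'''FermionInteraction t t' t'' t''' U).tiGroundEnergyDensityAt 2 ρ ≤
      u + 16 / Real.pi ^ 2 * (|t''| + 2 * |t'''|) := by
  refine (tiGroundEnergyDensityAt_tppp_le_trial hω₀ hρ t t' t'' t''' U).trans ?_
  have h3 := abs_le.1 (hω₀.abs_meanEnergy_axialRange2Hopping_le_of_any_density)
  have h4 := abs_le.1 hω₀.abs_knightEnergy_le
  have hx : t'' * ω₀.meanEnergy (axialRange2HoppingFermionInteraction 2 1) 2 ≤ 16 / Real.pi ^ 2 * |t''| := by
    calc _ ≤ |t'' * ω₀.meanEnergy (axialRange2HoppingFermionInteraction 2 1) 2| := le_abs_self _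
      _ = |t''| * |ω₀.meanEnergy (axialRange2HoppingFermionInteraction 2 1) 2| := abs_mul _ _
      _ ≤ |t''| * (16 / Real.pi ^ 2) := mul_le_mul_of_nonneg_left (abs_le.2 h3) (abs_nonneg _)
      _ = 16 / Real.pi ^ 2 * |t''| := mul_comm _ _
  have hy : t''' * ω₀.knightEnergy ≤ 32 / Real.pi ^ 2 * |t'''| := by
    calc _ ≤ |t''' * ω₀.knightEnergy| := le_abs_self _
      _ = |t'''| * |ω₀.knightEnergy| := abs_mul _ _
      _ ≤ |t'''| * (32 / Real.pi ^ 2) := mul_le_mul_of_nonneg_left (abs_le.2 h4) (abs_nonneg _)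
      _ = 32 / Real.pi ^ 2 * |t'''| := mul_comm _ _
  have : 16 / Real.pi ^ 2 * (|t''| + 2 * |t'''|) = 16 / Real.pi ^ 2 * |t''| + 32 / Real.pi ^ 2 * |t'''| := by ring
  linarith

end AnchorCaps

end Literature.MathematicalPhysics.QuantumLattice

end
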